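import Literature.MathematicalPhysics.QuantumFieldTheory.AbelianTorusCochains
import Literature.MathematicalPhysics.QuantumFieldTheory.CubicalCochainsBox
import Summits.QuantumFields.YangMills.Theorems.Z2SelfDualityBoxPoincare
import HarnessLib

/-!
# Primitives off the seam of the discrete torus (degrees one and two), seam counting

Support file for the Kramers–Wannier / Wegner self-duality of four-dimensional `ℤ₂` lattice gauge
theory on the torus (`…Theses.ModularSelfDualFold.Z2TorusFreeEnergySelfDuality`). On the torus
`(ℤ/Lℤ)^d` not every closed cochain is exact (cohomology of the torus), but after cutting the
torus open along its *seam* — the edges `(y, i)` with `y_i = L - 1` and the plaquettes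
`(y; i < j)` with `y_i = L - 1` or `y_j = L - 1`, i.e. the cells wrapping around — it is:

* `exists_potential_off_seam` (degree one): a flat `1`-cochain `φ` (`td₁ φ = 0`) is a pure gauge
  off the seam, `φ(y, i) = g(y + eᵢ) - g(y)` for every non-seam edge; from the tree's box Poincaré
  lemma `LatticeForm.exists_d₀_eq_of_flat_on_box` applied to the lift of `φ` to `ℤ^d`.
* `exists_td₁_eq_off_seam` (degree two): a closed function of the genuine plaquettes
  (`IsClosedPl η`) agrees with a plaquette field `res (td₁ θ)` on every non-seam plaquette; from the
  degree-two box Poincaré lemma `exists_d₁_eq_on_box` (cone primitive).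
* `card_seamEdge_le`, `card_seamPlaq_le`: the seam has `≤ d·L^{d-1}` edges and `≤ 2d²·L^{d-1}`
  plaquettes — negligible against the `L^d` sites in the thermodynamic limit.

Everything here is proved (pure lattice exterior calculus; Forsström–Lenells–Viklund 2022 §2).
-/

namespace Summit.QuantumFields.YangMills.Theorems.Z2SelfDuality

open Finset Function
open Literature.Probability.LatticeModels (Torus.proj Torus.proj_apply)
open Literature.MathematicalPhysics.QuantumFieldTheory
open Literature.MathematicalPhysics.QuantumFieldTheory.LatticeForm

variable {d L : ℕ} {A : Type*} [AddCommGroup A]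

/-! ### The seam of the torus -/

/-- The **seam edges** of the torus `(ℤ/Lℤ)^d`: the edges `(y, i)` with `y_i = L - 1`, i.e. those
wrapping around from `L - 1` to `0`. [folklore] -/
def seamEdge (d L : ℕ) [NeZero L] : Finset (Edge d L) :=
  Finset.univ.filter fun e => (e.1 e.2).val = L - 1

/-- The **seam plaquettes** of the torus: the genuine plaquettes `(y; i < j)` with `y_i = L - 1` or
`y_j = L - 1`. [folklore] -/
def seamPlaq (d L : ℕ) [NeZero L] : Finset (Plaquette d L) :=
  Finset.univ.filter fun p => (p.1 p.2.1.1).val = L - 1 ∨ (p.1 p.2.1.2).val = L - 1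

/-- Membership in the seam edges. [folklore] -/
theorem mem_seamEdge [NeZero L] {e : Edge d L} : e ∈ seamEdge d L ↔ (e.1 e.2).val = L - 1 := by
  simp [seamEdge]

/-- Membership in the seam plaquettes. [folklore] -/
theorem mem_seamPlaq [NeZero L] {p : Plaquette d L} :
    p ∈ seamPlaq d L ↔ (p.1 p.2.1.1).val = L - 1 ∨ (p.1 p.2.1.2).val = L - 1 := by
  simp [seamPlaq]

/-- The sites with one prescribed coordinate number `L^{d-1}`. [folklore] -/
theorem card_filter_apply_eq [NeZero L] (i : Fin d) (c : ZMod L) :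
    (Finset.univ.filter fun y : Site d L => y i = c).card = L ^ (d - 1) := by
  classical
  have hset : (Finset.univ.filter fun y : Site d L => y i = c) =
      Fintype.piFinset fun m => if m = i then ({c} : Finset (ZMod L)) else Finset.univ := by
    ext y
    simp only [Finset.mem_filter, Finset.mem_univ, true_and, Fintype.mem_piFinset]
    constructor
    · intro h m
      by_cases hm : m = i
      · subst hm; simp [h]
      · simp [hm]
    · intro h
      simpa using h i
  rw [hset, Fintype.card_piFinset]
  simp only [apply_ite Finset.card, Finset.card_singleton, Finset.card_univ, ZMod.card]
  rw [Finset.prod_ite, Finset.prod_const_one, one_mul, Finset.prod_const]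
  congr 1
  rw [Finset.filter_not, Finset.filter_eq' Finset.univ i, if_pos (Finset.mem_univ i),
    Finset.card_univ_sdiff, Fintype.card_fin, Finset.card_singleton]

/-- The value `L - 1` as a residue, through `ZMod.val`. [folklore] -/
theorem val_eq_sub_one_iff [NeZero L] (z : ZMod L) :
    z.val = L - 1 ↔ z = ((L - 1 : ℕ) : ZMod L) := by
  constructor
  · intro h
    rw [← ZMod.natCast_zmod_val z, h]
  · intro h
    rw [h, ZMod.val_natCast]
    exact Nat.mod_eq_of_lt (Nat.sub_lt (Nat.pos_of_ne_zero (NeZero.ne L)) one_pos)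

/-- **The seam has few edges**: `#seamEdge ≤ d · L^{d-1}`. [folklore] -/
theorem card_seamEdge_le [NeZero L] : (seamEdge d L).card ≤ d * L ^ (d - 1) := by
  classical
  set c : ZMod L := ((L - 1 : ℕ) : ZMod L) with hc
  set F : Fin d → Finset (Site d L) := fun i => Finset.univ.filter fun y => y i = c with hF
  have hsub : seamEdge d L ⊆ Finset.univ.biUnion fun i => (F i).image fun y => (y, i) := by
    intro e he
    rw [mem_seamEdge] at he
    simp only [Finset.mem_biUnion, Finset.mem_univ, true_and, Finset.mem_image]
    refine ⟨e.2, e.1, ?_, rfl⟩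
    simp only [hF, Finset.mem_filter, Finset.mem_univ, true_and]
    exact (val_eq_sub_one_iff _).1 he
  calc (seamEdge d L).card
      ≤ (Finset.univ.biUnion fun i => (F i).image fun y => (y, i)).card := Finset.card_le_card hsub
    _ ≤ ∑ i : Fin d, ((F i).image fun y => (y, i)).card := Finset.card_biUnion_le
    _ ≤ ∑ i : Fin d, (F i).card := Finset.sum_le_sum fun i _ => Finset.card_image_le
    _ = ∑ _i : Fin d, L ^ (d - 1) := Finset.sum_congr rfl fun i _ => by
        rw [hF]; exact card_filter_apply_eq i c
    _ = d * L ^ (d - 1) := by simp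

/-- **The seam has few plaquettes**: `#seamPlaq ≤ 2 · d² · L^{d-1}`. [folklore] -/
theorem card_seamPlaq_le [NeZero L] : (seamPlaq d L).card ≤ 2 * (d * d) * L ^ (d - 1) := by
  classical
  set c : ZMod L := ((L - 1 : ℕ) : ZMod L) with hc
  set F : Fin d → Finset (Site d L) := fun i => Finset.univ.filter fun y => y i = c with hF
  set Q := (Finset.univ : Finset {q : Fin d × Fin d // q.1 < q.2}) with hQ
  have hsub : seamPlaq d L ⊆ Q.biUnion fun q => (F q.1.1 ∪ F q.1.2).image fun y => (y, q) := by
    intro p hp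
    rw [mem_seamPlaq] at hp
    simp only [hQ, Finset.mem_biUnion, Finset.mem_univ, true_and, Finset.mem_image]
    refine ⟨p.2, p.1, ?_, rfl⟩
    simp only [hF, Finset.mem_union, Finset.mem_filter, Finset.mem_univ, true_and]
    rcases hp with h | h
    · exact Or.inl ((val_eq_sub_one_iff _).1 h)
    · exact Or.inr ((val_eq_sub_one_iff _).1 h)
  have hQcard : Q.card ≤ d * d := by
    calc Q.card = Fintype.card {q : Fin d × Fin d // q.1 < q.2} := Finset.card_univ
      _ ≤ Fintype.card (Fin d × Fin d) := Fintype.card_subtype_le _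
      _ = d * d := by simp
  calc (seamPlaq d L).card
      ≤ (Q.biUnion fun q => (F q.1.1 ∪ F q.1.2).image fun y => (y, q)).card := Finset.card_le_card hsub
    _ ≤ ∑ q ∈ Q, ((F q.1.1 ∪ F q.1.2).image fun y => (y, q)).card := Finset.card_biUnion_le
    _ ≤ ∑ q ∈ Q, (F q.1.1 ∪ F q.1.2).card := Finset.sum_le_sum fun q _ => Finset.card_image_le
    _ ≤ ∑ q ∈ Q, ((F q.1.1).card + (F q.1.2).card) :=
        Finset.sum_le_sum fun q _ => Finset.card_union_le _ _
    _ = ∑ _q ∈ Q, 2 * L ^ (d - 1) := Finset.sum_congr rfl fun q _ => by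
        rw [hF, card_filter_apply_eq q.1.1 c, card_filter_apply_eq q.1.2 c]; ring
    _ = Q.card * (2 * L ^ (d - 1)) := by simp
    _ ≤ (d * d) * (2 * L ^ (d - 1)) := Nat.mul_le_mul_right _ hQcard
    _ = 2 * (d * d) * L ^ (d - 1) := by ring

/-! ### Lifting torus cochains to `ℤ^d` -/

section Transfer

variable [NeZero L]

omit [NeZero L] in
/-- The projection `ℤ^d → (ℤ/Lℤ)^d` takes `x + eᵢ` to `proj x + eᵢ`. [folklore] -/
theorem proj_add_e (x : Literature.Probability.LatticeModels.Site d) (i : Fin d) :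
    (Torus.proj L (x + e i) : Site d L) = Torus.proj L x + te i := by
  rw [torusProj_site_add, torusProj_site_single]

/-- Off the seam the canonical lift commutes with `+ eᵢ`. [folklore] -/
theorem torusSiteLift_add_te_of_ne {y : Site d L} {i : Fin d} (h : (y i).val ≠ L - 1) :
    torusSiteLift (y + te i) = torusSiteLift y + e i := by
  rw [torusSiteLift_add_te]
  have h' : ((y i).val : ℤ) ≠ (L : ℤ) - 1 := by
    have := ZMod.val_lt (y i)
    have hL := Nat.pos_of_ne_zero (NeZero.ne L)
    omega
  rw [if_neg h']

/-- Off the seam, `lift y + eᵢ` stays in the fundamental domain. [folklore] -/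
theorem torusSiteLift_add_e_mem_fundBox {y : Site d L} {i : Fin d} (h : (y i).val ≠ L - 1) :
    torusSiteLift y + e i ∈ fundBox d L := by
  rw [← torusSiteLift_add_te_of_ne h]
  exact torusSiteLift_mem_fundBox _

/-- Off the seam in two directions, `lift y + eᵢ + eⱼ` stays in the fundamental domain. [folklore] -/
theorem torusSiteLift_add_e_add_e_mem_fundBox {y : Site d L} {i j : Fin d} (hij : i ≠ j)
    (hi : (y i).val ≠ L - 1) (hj : (y j).val ≠ L - 1) :
    torusSiteLift y + e i + e j ∈ fundBox d L := by
  have hj' : ((y + te i : Site d L) j).val ≠ L - 1 := by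
    simp only [Pi.add_apply, te, Pi.single_eq_of_ne hij.symm, add_zero]
    exact hj
  rw [← torusSiteLift_add_te_of_ne hi, ← torusSiteLift_add_te_of_ne hj']
  exact torusSiteLift_mem_fundBox _

/-- **Degree one: flat cochains are pure gauges off the seam.** If the torus `1`-cochain `φ` is
flat (`td₁ φ = 0`) then there is a `0`-cochain `g` with `g (y + eᵢ) - g y = φ (y, i)` for every
non-seam edge `(y, i)` (`y_i ≠ L - 1`). [cite: ForsstromLenellsViklund2022, §2 (Lemma 2.2, the Poincaré lemma)] -/
theorem exists_potential_off_seam {φ : Site d L → Fin d → A} (hφ : ∀ y i j, td₁ φ y i j = 0) :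
    ∃ g : Site d L → A, ∀ (y : Site d L) (i : Fin d), (y i).val ≠ L - 1 →
      g (y + te i) - g y = φ y i := by
  -- lift to `ℤ^d`: flat everywhere
  set V : Literature.Probability.LatticeModels.Site d → Fin d → A := fun x i => φ (Torus.proj L x) i
    with hV
  have hflat : ∀ (x : Literature.Probability.LatticeModels.Site d) (i j : Fin d),
      x ∈ Set.Icc (0 : Literature.Probability.LatticeModels.Site d) (fun _ => (L : ℤ) - 1) →
      x + e i + e j ∈ Set.Icc (0 : Literature.Probability.LatticeModels.Site d) (fun _ => (L : ℤ) - 1) →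
      d₁ V x i j = 0 := by
    intro x i j _ _
    have := hφ (Torus.proj L x) i j
    simp only [td₁] at this
    simp only [d₁, hV, proj_add_e]
    exact this
  obtain ⟨g₀, hg₀⟩ := exists_d₀_eq_of_flat_on_box V 0 (fun _ => (L : ℤ) - 1) hflat
  refine ⟨fun y => g₀ (torusSiteLift y), fun y i hi => ?_⟩
  have h1 := hg₀ (torusSiteLift y) i (torusSiteLift_mem_fundBox y) (torusSiteLift_add_e_mem_fundBox hi)
  simp only [d₀, hV, torusProj_torusSiteLift] at h1
  show g₀ (torusSiteLift (y + te i)) - g₀ (torusSiteLift y) = φ y i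
  rw [torusSiteLift_add_te_of_ne hi]
  exact h1

/-- **Degree two: closed plaquette functions are plaquette fields off the seam.** If `η` is a
closed function of the genuine plaquettes of the torus (`IsClosedPl η`: no flux out of any
`3`-cell) then there is a `1`-cochain `θ` whose plaquette field `res (td₁ θ)` agrees with `η` on
every non-seam plaquette. [cite: ForsstromLenellsViklund2022, §2 (Lemma 2.2, the Poincaré lemma)] -/
theorem exists_td₁_eq_off_seam {η : Plaquette d L → A} (hη : IsClosedPl η) :
    ∃ θ : Site d L → Fin d → A, ∀ p : Plaquette d L, p ∉ seamPlaq d L → res (td₁ θ) p = η p := by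
  set ω := ext η with hω
  have halt : IsAlt ω := isAlt_ext η
  -- lift to `ℤ^d`: closed everywhere
  set V : Literature.Probability.LatticeModels.Site d → Fin d → Fin d → A :=
    fun x i j => ω (Torus.proj L x) i j with hV
  have hcl : ∀ (z : Literature.Probability.LatticeModels.Site d) (n i j : Fin d), n < i → i < j →
      z ∈ Set.Icc (0 : Literature.Probability.LatticeModels.Site d) (fun _ => (L : ℤ) - 1) →
      z + e n + e i + e j ∈ Set.Icc (0 : Literature.Probability.LatticeModels.Site d) (fun _ => (L : ℤ) - 1) →
      d₂ V z n i j = 0 := by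
    intro z n i j _ _ _ _
    have := hη (Torus.proj L z) n i j
    simp only [td₂] at this
    simp only [d₂, hV, proj_add_e]
    exact this
  obtain ⟨θ₀, hθ₀⟩ := exists_d₁_eq_on_box V 0 (fun _ => (L : ℤ) - 1)
    (fun x i j => halt.1 _ i j) (fun x i => halt.2 _ i) hcl
  refine ⟨pushCochain θ₀, fun p hp => ?_⟩
  obtain ⟨y, ⟨i, j⟩, hij⟩ := p
  rw [mem_seamPlaq, not_or] at hp
  obtain ⟨hi, hj⟩ := hp
  have h1 := hθ₀ (torusSiteLift y) i j (torusSiteLift_mem_fundBox y)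
    (torusSiteLift_add_e_add_e_mem_fundBox hij.ne hi hj)
  simp only [res, td₁, pushCochain]
  rw [torusSiteLift_add_te_of_ne hi, torusSiteLift_add_te_of_ne hj]
  simp only [d₁, hV, torusProj_torusSiteLift] at h1
  rw [h1, hω, ext_apply_of_lt η y hij]

end Transfer

end Summit.QuantumFields.YangMills.Theorems.Z2SelfDuality
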